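import Summits.AtomisticToContinuum.HydrodynamicLimit.Theses.ImplosionDichotomy
import Summits.AtomisticToContinuum.HydrodynamicLimit.Theorems.DenseExcursion.Negative.Dichotomy
import Summits.AtomisticToContinuum.HydrodynamicLimit.Theorems.ImplosionDichotomyIdealGasImplosionHolds
import Summits.AtomisticToContinuum.HydrodynamicLimit.Theorems.ImplosionDichotomyDiluteSelfConsistencyTimeLocalisation
import Literature.Analysis.FunctionSpaces.FlatTorus

/-!
# `DiluteSelfConsistency` (stmt-AtomisticToContinuum-3091) — crux-strategist gen 3, instance armed on bet route
# `InformationPercolationEngine` (seat folder …-3091-s1-0), kernel part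

Companion of `STRATEGY-CENSUS.md` PART 0-IPE (gen 3, 2026-08-17). NOT a skeleton (no `stub_*`; nothing here is offered
to a lead). Distinct file/namespace from the sibling instance's `StrategistSketchS1.lean` (same seat folder, bet route
TwoClocks) so that neither overwrites the other. Kernel-checked here:

* §0 STATE. With the time localisation landed (`diluteSelfConsistency_iff_postWindow`, line `birth` rev c3), the one
  open stub B.2 `stub_postWindowDilute` is LITERALLY the sibling crux's negation: `PostWindow ↔ ¬ DenseExcursion`
  (`postWindow_iff_not_denseExcursion`, two landed `Iff`s composed).
* §S STRENGTHEN, new rigid form S⁺_F "freeze the equation of state at its limit": keep the packing functional `ρσ³`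
  at scale `σ` but let the solutions be those of the LIMIT system (`IsHardSphereEulerSolution 0` = monatomic ideal
  gas, the `σ_eos = 0` member of the EOS family). This is the form a STRUCTURAL proof (one using only "hs-EOS → ideal
  as σ → 0", i.e. `EosContinuity`-type information, and no quantitative feedback of the excluded-volume pressure on
  the flow) would deliver. It is REFUTED IN-TREE: `frozenEos_iff_idealCompressionBounded` (S⁺_F ⟺ every profile has
  σ = 0 developments of bounded density, i.e. split A's Case II class is EMPTY) and `not_diluteSelfConsistencyFrozenEos`
  (from the unconditional `idealGasImplosion_holds`: BCG shooting certified in 32 window bricks). Reading: the crux is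
  "false without the EOS–packing coupling `σ_eos = σ_pack` acting AT the ideal first singularity" — exactly the
  Melnikov mechanism the DenseExcursion record measures (and finds tuned to zero at SS(r₂)).
* §D DECOMPOSITION, new typed candidate N "analytic reduction": `DSCAnalytic ∧ (DSCAnalytic → DSC)`, glue = modus
  ponens, piece 1 exact (`dscAnalytic_of_dsc`). Typed to show it CAN be typed; the census explains why piece 2 is the
  crux again (per-σ continuous dependence has `δ = δ(σ)` past the pre-singular window) and why piece 1 is as false as
  the crux (analytic tuned threshold data). Not filed.
-/

noncomputable section

namespace Summit.AtomisticToContinuum.HydrodynamicLimit.Cruxes.DiluteSelfConsistency.StrategistS1IPE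

open MeasureTheory Filter Set Topology
open Literature.MathematicalPhysics.KineticTheory Literature.Analysis.FluidPDE Literature.Analysis.FunctionSpaces
open Summit.AtomisticToContinuum.HydrodynamicLimit.Theses.ImplosionDichotomy
open Summit.AtomisticToContinuum.HydrodynamicLimit.Theorems
open Summit.AtomisticToContinuum.HydrodynamicLimit.Theorems.DenseExcursionDichotomy

/-! ## §0 State: the open stub B.2 is `¬ DenseExcursion` up to two landed `Iff`s -/

/-- Piece B.2 (post-window diluteness), verbatim the right-hand side of the landed
`diluteSelfConsistency_iff_postWindow` and the statement of the registered stub `stub_postWindowDilute`. -/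
def PostWindow : Prop :=
  ∀ η : ℝ, 0 < η → ∀ (a₀ θ₀ : T3 → ℝ) (u₀ : T3 → V3), Continuous a₀ → Continuous θ₀ → Continuous u₀ →
    (∀ x, 0 < a₀ x) → (∀ x, 0 < θ₀ x) →
    ∀ (T₁ : ℝ) (ρ₁ θ₁ : ℝ → T3 → ℝ) (u₁ : ℝ → T3 → V3), 0 < T₁ → IsHardSphereEulerSolution 0 T₁ ρ₁ u₁ θ₁ →
      (∀ x, ρ₁ 0 x = a₀ x / ∫ y, a₀ y) → u₁ 0 = u₀ → θ₁ 0 = θ₀ →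
      ∃ T₂ : ℝ, 0 < T₂ ∧ T₂ < T₁ ∧ ∃ σ₀ : ℝ, 0 < σ₀ ∧ ∀ σ : ℝ, 0 < σ → σ < σ₀ →
        ∀ (T : ℝ) (ρ θ : ℝ → T3 → ℝ) (u : ℝ → T3 → V3), IsHardSphereEulerSolution σ T ρ u θ →
          ∀ Φ : (N : ℕ) → HardSphereFlow (Torus.geometry (Fin 3)) (hsDiameter σ N) (N + 1),
            TendstoHydroFieldsAt (fun N => localGibbsLaw σ a₀ u₀ θ₀ N (Φ N)) Φ ρ u θ 0 →
              ∀ t ∈ Ico 0 T, T₂ < t → ∀ x, ρ t x * σ ^ 3 < η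

/-- The crux IS its post-window piece (landed, line `birth` rev c3). [folklore] -/
theorem dsc_iff_postWindow : DiluteSelfConsistency ↔ PostWindow :=
  diluteSelfConsistency_iff_postWindow

/-- **The open stub is the sibling's negation**: B.2 ↔ `¬ DenseExcursion` (stmt-AtomisticToContinuum-12586).
Composition of `diluteSelfConsistency_iff_postWindow` and `not_denseExcursion_iff_diluteSelfConsistency`. [folklore] -/
theorem postWindow_iff_not_denseExcursion : PostWindow ↔ ¬ DenseExcursion :=
  diluteSelfConsistency_iff_postWindow.symm.trans not_denseExcursion_iff_diluteSelfConsistency.symm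

/-! ## §S Strengthen — S⁺_F "frozen equation of state" is refuted in-tree -/

/-- **S⁺_F (frozen EOS).** The crux with the equation of state frozen at its `σ → 0` limit (solutions of the IDEAL
system `IsHardSphereEulerSolution 0`, reference data `(a₀/∫a₀, u₀, θ₀)`), the packing still measured at scale `σ`.
The decoupled/structural form of the crux: what "EOS → ideal" alone could give. -/
def DiluteSelfConsistencyFrozenEos : Prop :=
  ∀ η : ℝ, 0 < η → ∀ (a₀ θ₀ : T3 → ℝ) (u₀ : T3 → V3), Continuous a₀ → Continuous θ₀ → Continuous u₀ →
    (∀ x, 0 < a₀ x) → (∀ x, 0 < θ₀ x) → ∃ σ₀ : ℝ, 0 < σ₀ ∧ ∀ σ : ℝ, 0 < σ → σ < σ₀ →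
      ∀ (T : ℝ) (ρ θ : ℝ → T3 → ℝ) (u : ℝ → T3 → V3), IsHardSphereEulerSolution 0 T ρ u θ →
        (∀ x, ρ 0 x = a₀ x / ∫ y, a₀ y) → u 0 = u₀ → θ 0 = θ₀ → ∀ t ∈ Ico 0 T, ∀ x, ρ t x * σ ^ 3 < η

/-- The classifier of split A at one profile: all ideal classical developments of the reference data have density
bounded by one constant. -/
def IdealCompressionBounded (a₀ θ₀ : T3 → ℝ) (u₀ : T3 → V3) : Prop :=
  ∃ M : ℝ, ∀ (T₁ : ℝ) (ρ₁ θ₁ : ℝ → T3 → ℝ) (u₁ : ℝ → T3 → V3), IsHardSphereEulerSolution 0 T₁ ρ₁ u₁ θ₁ →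
    (∀ x, ρ₁ 0 x = a₀ x / ∫ y, a₀ y) → u₁ 0 = u₀ → θ₁ 0 = θ₀ → ∀ t ∈ Ico 0 T₁, ∀ x, ρ₁ t x ≤ M

/-- **S⁺_F is exactly "Case II is empty"**: the frozen-EOS crux holds iff EVERY continuous positive profile has ideal
developments of bounded density. (`→`: level `η = 1`, `σ = σ₀/2`, `M = (σ₀/2)⁻³`. `←`: `σ₀ = min 1 (η/(|M|+1))`.)
[folklore] -/
theorem frozenEos_iff_idealCompressionBounded :
    DiluteSelfConsistencyFrozenEos ↔
      ∀ (a₀ θ₀ : T3 → ℝ) (u₀ : T3 → V3), Continuous a₀ → Continuous θ₀ → Continuous u₀ →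
        (∀ x, 0 < a₀ x) → (∀ x, 0 < θ₀ x) → IdealCompressionBounded a₀ θ₀ u₀ := by
  constructor
  · intro h a₀ θ₀ u₀ ha hθ hu ha0 hθ0
    obtain ⟨σ₀, hσ₀, H⟩ := h 1 one_pos a₀ θ₀ u₀ ha hθ hu ha0 hθ0
    have hσ : 0 < σ₀ / 2 := by positivity
    have hpow : 0 < (σ₀ / 2) ^ 3 := by positivity
    refine ⟨((σ₀ / 2) ^ 3)⁻¹, ?_⟩
    intro T₁ ρ₁ θ₁ u₁ hsol hd hu0 hθ0' t ht x
    have hlt : ρ₁ t x * (σ₀ / 2) ^ 3 < 1 := H (σ₀ / 2) hσ (by linarith) T₁ ρ₁ θ₁ u₁ hsol hd hu0 hθ0' t ht x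
    rw [inv_eq_one_div, le_div_iff₀ hpow]
    exact hlt.le
  · intro h η hη a₀ θ₀ u₀ ha hθ hu ha0 hθ0
    obtain ⟨M, hM⟩ := h a₀ θ₀ u₀ ha hθ hu ha0 hθ0
    have hK : 0 < |M| + 1 := by positivity
    refine ⟨min 1 (η / (|M| + 1)), lt_min one_pos (div_pos hη hK), ?_⟩
    intro σ hσ hσlt T ρ θ u hsol hd hu0 hθ0' t ht x
    have hσ1 : σ < 1 := lt_of_lt_of_le hσlt (min_le_left _ _)
    have hσ2 : σ < η / (|M| + 1) := lt_of_lt_of_le hσlt (min_le_right _ _)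
    have hρ : ρ t x ≤ M := hM T ρ θ u hsol hd hu0 hθ0' t ht x
    have hρ' : ρ t x ≤ |M| := hρ.trans (le_abs_self M)
    have hσ3 : σ ^ 3 ≤ σ := by
      have h2 : σ ^ 2 ≤ 1 := by nlinarith
      nlinarith
    have hσpos3 : 0 < σ ^ 3 := by positivity
    have step1 : ρ t x * σ ^ 3 ≤ |M| * σ ^ 3 := mul_le_mul_of_nonneg_right hρ' hσpos3.le
    have step2 : |M| * σ ^ 3 ≤ |M| * σ := mul_le_mul_of_nonneg_left hσ3 (abs_nonneg M)
    have step3 : |M| * σ < (|M| + 1) * (η / (|M| + 1)) := by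
      have h4 : |M| * σ ≤ |M| * (η / (|M| + 1)) := mul_le_mul_of_nonneg_left hσ2.le (abs_nonneg M)
      have hq : 0 < η / (|M| + 1) := div_pos hη hK
      have h5 : |M| * (η / (|M| + 1)) < (|M| + 1) * (η / (|M| + 1)) := by nlinarith
      exact lt_of_le_of_lt h4 h5
    have step4 : (|M| + 1) * (η / (|M| + 1)) = η := by field_simp
    linarith

/-- **S⁺_F refuted in-tree.** The frozen-EOS crux is FALSE: the tree holds an unconditional ideal-gas implosion from
continuous positive data on `𝕋³` (`idealGasImplosion_holds`, stmt-AtomisticToContinuum-12588: BCG self-similar profile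
at `γ = 5/3`, 32 certified window bricks, backward exterior solution, domain of dependence). So every proof of the crux
must use the coupling `σ_eos = σ_pack` QUANTITATIVELY at the ideal first singularity — the excluded-volume pressure must
itself deflect the collapse before packing `η`; "EOS → ideal" information (`EosContinuity`, B.1) can never suffice.
[cite: BuckmasterCaolaboraGomezserrano2025, Thm 1.1] [cite: CaolaboraEtAl2025, Thm 1.2 + Rem 1.4 + Rem 1.5] -/
theorem not_diluteSelfConsistencyFrozenEos : ¬ DiluteSelfConsistencyFrozenEos := by
  intro h
  obtain ⟨a₀, θ₀, u₀, ha, hθ, hu, ha0, hθ0, T₁, ρ₁, θ₁, u₁, _hT₁, hsol, hd, hu0, hθ0', hunb⟩ :=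
    idealGasImplosion_holds
  obtain ⟨M, hM⟩ := (frozenEos_iff_idealCompressionBounded.1 h) a₀ θ₀ u₀ ha hθ hu ha0 hθ0
  obtain ⟨t, ht, x, hx⟩ := hunb (M + 1)
  have := hM T₁ ρ₁ θ₁ u₁ hsol hd hu0 hθ0' t ht x
  linarith

/-- Corollary recorded for the census: Case II's hypothesis class is INHABITED in the tree (there is a continuous
positive profile whose ideal developments are not uniformly bounded) — so split A's expected-false leaf is not vacuous.
[folklore] -/
theorem exists_profile_not_idealCompressionBounded :
    ∃ (a₀ θ₀ : T3 → ℝ) (u₀ : T3 → V3), Continuous a₀ ∧ Continuous θ₀ ∧ Continuous u₀ ∧ (∀ x, 0 < a₀ x) ∧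
      (∀ x, 0 < θ₀ x) ∧ ¬ IdealCompressionBounded a₀ θ₀ u₀ := by
  obtain ⟨a₀, θ₀, u₀, ha, hθ, hu, ha0, hθ0, T₁, ρ₁, θ₁, u₁, _hT₁, hsol, hd, hu0, hθ0', hunb⟩ :=
    idealGasImplosion_holds
  refine ⟨a₀, θ₀, u₀, ha, hθ, hu, ha0, hθ0, ?_⟩
  rintro ⟨M, hM⟩
  obtain ⟨t, ht, x, hx⟩ := hunb (M + 1)
  have := hM T₁ ρ₁ θ₁ u₁ hsol hd hu0 hθ0' t ht x
  linarith

/-- **The crux relative to its frozen form**: at a profile whose ideal developments are bounded (S⁺_F holds there),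
the crux is split A's Case I; at the others (inhabited, `exists_profile_not_idealCompressionBounded`) it is Case II,
`¬ DenseExcursion` in substance. The landed exact split `diluteSelfConsistency_of_idealFate` /
`idealFate_of_diluteSelfConsistency` is recovered: the frozen form is the CLASSIFIER of split A, not a lever. [folklore] -/
theorem dsc_iff_idealFate_split :
    DiluteSelfConsistency ↔
      ((∀ η : ℝ, 0 < η → ∀ (a₀ θ₀ : T3 → ℝ) (u₀ : T3 → V3) (ha : Continuous a₀) (ha0 : ∀ x, 0 < a₀ x),
          Continuous θ₀ → Continuous u₀ → (∀ x, 0 < θ₀ x) → IdealCompressionBounded a₀ θ₀ u₀ →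
          ∃ σ₀ : ℝ, 0 < σ₀ ∧ ∀ σ : ℝ, 0 < σ → σ < σ₀ →
            ∀ (T : ℝ) (ρ θ : ℝ → T3 → ℝ) (u : ℝ → T3 → V3), IsHardSphereEulerSolution σ T ρ u θ →
              ρ 0 = rhoLim (profileOf a₀ ha ha0) σ → u 0 = u₀ → θ 0 = θ₀ →
                ∀ t ∈ Ico 0 T, ∀ x, ρ t x * σ ^ 3 < η) ∧
        (∀ η : ℝ, 0 < η → ∀ (a₀ θ₀ : T3 → ℝ) (u₀ : T3 → V3) (ha : Continuous a₀) (ha0 : ∀ x, 0 < a₀ x),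
          Continuous θ₀ → Continuous u₀ → (∀ x, 0 < θ₀ x) → ¬ IdealCompressionBounded a₀ θ₀ u₀ →
          ∃ σ₀ : ℝ, 0 < σ₀ ∧ ∀ σ : ℝ, 0 < σ → σ < σ₀ →
            ∀ (T : ℝ) (ρ θ : ℝ → T3 → ℝ) (u : ℝ → T3 → V3), IsHardSphereEulerSolution σ T ρ u θ →
              ρ 0 = rhoLim (profileOf a₀ ha ha0) σ → u 0 = u₀ → θ 0 = θ₀ →
                ∀ t ∈ Ico 0 T, ∀ x, ρ t x * σ ^ 3 < η)) :=
  ⟨idealFate_of_diluteSelfConsistency, fun h => diluteSelfConsistency_of_idealFate h.1 h.2⟩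

/-! ## §D Decomposition — candidate N (analytic reduction), typed; not filed -/

/-- Real-analytic profile triple (lifts to `ℝ³` analytic everywhere). -/
def AnalyticProfile (a₀ θ₀ : T3 → ℝ) (u₀ : T3 → V3) : Prop :=
  AnalyticOnNhd ℝ (Torus.lift a₀) Set.univ ∧ AnalyticOnNhd ℝ (Torus.lift θ₀) Set.univ ∧
    AnalyticOnNhd ℝ (Torus.lift u₀) Set.univ

/-- Piece N.1: the crux restricted to real-analytic profiles. -/
def DSCAnalytic : Prop :=
  ∀ η : ℝ, 0 < η → ∀ (a₀ θ₀ : T3 → ℝ) (u₀ : T3 → V3), Continuous a₀ → Continuous θ₀ → Continuous u₀ →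
    (∀ x, 0 < a₀ x) → (∀ x, 0 < θ₀ x) → AnalyticProfile a₀ θ₀ u₀ →
    ∃ σ₀ : ℝ, 0 < σ₀ ∧ ∀ σ : ℝ, 0 < σ → σ < σ₀ →
      ∀ (T : ℝ) (ρ θ : ℝ → T3 → ℝ) (u : ℝ → T3 → V3), IsHardSphereEulerSolution σ T ρ u θ →
        ∀ Φ : (N : ℕ) → HardSphereFlow (Torus.geometry (Fin 3)) (hsDiameter σ N) (N + 1),
          TendstoHydroFieldsAt (fun N => localGibbsLaw σ a₀ u₀ θ₀ N (Φ N)) Φ ρ u θ 0 →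
            ∀ t ∈ Ico 0 T, ∀ x, ρ t x * σ ^ 3 < η

/-- Piece N.2: analytic profiles suffice (a σ-UNIFORM approximation/closure statement). -/
def AnalyticSuffices : Prop := DSCAnalytic → DiluteSelfConsistency

/-- (b) glue of candidate N: modus ponens (`trivial_seam`). [folklore] -/
theorem dsc_of_analyticSplit (h1 : DSCAnalytic) (h2 : AnalyticSuffices) : DiluteSelfConsistency := h2 h1

/-- Piece N.1 is a consequence of the crux (restriction), so the split is exact on N.1. [folklore] -/
theorem dscAnalytic_of_dsc (h : DiluteSelfConsistency) : DSCAnalytic :=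
  fun η hη a₀ θ₀ u₀ ha hθ hu ha0 hθ0 _ => h η hη a₀ θ₀ u₀ ha hθ hu ha0 hθ0

end Summit.AtomisticToContinuum.HydrodynamicLimit.Cruxes.DiluteSelfConsistency.StrategistS1IPE

end
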